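import Literature.AlgebraicGeometry.FundamentalGroup.HypersurfaceComplementPencilDiscriminantFixedBase
import Literature.NumberTheory.Transcendental.RoySmallValueFactors
import Literature.Combinatorics.Extremal.LinesThroughPointOfSurface
import HarnessLib

/-!
# `h` squarefree ⇒ `h(b + X v)` squarefree in `ℂ[v][X]` for `h(b) ≠ 0`; hence through every point off a reduced
# hypersurface passes a line meeting it transversally in `deg h` points (Dimca Ch. 4 Prop. (3.1), pointed form)

Family `hodge`, layer `Literature/AlgebraicGeometry/FundamentalGroup`; theorems only, no named fact.  Written by the
prover seat `hodge-nonav-prover-Ax` (g15, cell `hodge-nonav`), programme «FIXED-BASE BERTINI», sequel of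
`HypersurfaceComplementPencilDiscriminantFixedBase` (which reduces the existence of a transversal line through `b` to
the squarefreeness of `halfLinePoly h b = h(b + X v)`).

THE ARGUMENT (homogenisation; no dimension theory).  Suppose `x² ∣ h(b + Xv)` in `A[X]`, `A = ℂ[v]`, `deg_X = D`.
Reflecting in `X` (`Polynomial.reflect`, multiplicative) gives `x̃² ∣ Q := reflect D (h(b + Xv))`; under
`MvPolynomial.optionEquivLeft` the polynomial `Q` is a FORM of degree `D` in `(v, t)` because `coeff_j h(b + Xv)` is a
form of degree `j` in `v` (`isHomogeneous_coeff_halfLinePoly`) — it is the homogenisation of `h(b + v)`.  Divisors of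
forms are forms (tree: `Roy2013.isHomogeneous_of_dvd`), so `x̃` is a form of some degree `τ`; setting `t = 1`
(`Polynomial.eval 1`) sends `Q` to `h(b + v)`, which is squarefree (a translate of `h`), so `x̃(1) ∈ A` is a unit, a
constant `c`; a form whose dehomogenisation is constant is `c·t^τ` (`eq_C_mul_X_pow_of_isHomogeneous_of_eval_one`), and
reflecting back, `x` is `c·X^k`; `k ≥ 1` contradicts `h(b) ≠ 0`, `k = 0` makes `x` a unit.

* `isHomogeneous_coeff_halfLinePoly`, `isHomogeneous_optionEquivLeft_symm`, `coeff_optionEquivLeft_eq_zero_of_lt`,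
  `eq_C_mul_X_pow_of_isHomogeneous_of_eval_one`, `eval_one_halfLinePoly` (`= translate b h`);
* **`squarefree_halfLinePoly`**, **`exists_eval_pencilDiscr_ne_zero_of_squarefree`**: `Squarefree h`, `h(b) ≠ 0` ⇒
  `∃ v, pencilDiscr h (b, v) ≠ 0`; **`squarefree_of_pencilDiscr_ne_zero`**: conversely `pencilDiscr h ≠ 0 ⇒ Squarefree h`
  (so the reduced discriminant equations produced by `exists_sameZeros_pencilDiscr_ne_zero` qualify BY THEIR OWN OUTPUT).

## References
* [Dimca1992] A. Dimca, *Singularities and Topology of Hypersurfaces* (1992), Ch. 4 §3 Prop. (3.1) and the remark after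
  it (the generic line through a point is transversal).
* [Shafarevich1994] I. R. Shafarevich, *Basic Algebraic Geometry 1* (1994), Book 1 I §3.1, II §6.4 (forms, homogenisation).
-/

noncomputable section

open MvPolynomial Polynomial

namespace Literature.AlgebraicGeometry.FundamentalGroup

variable {ι : Type}

/-! ### §1 The coefficients of `h(b + X v)` are forms -/

section Coeffs

variable (b : ι → ℂ)

/-- `halfLinePoly` of a constant. [cite: Dimca1992, Ch. 4 §3 Prop. (3.1)] -/
theorem halfLinePoly_C (a : ℂ) : halfLinePoly (MvPolynomial.C a : MvPolynomial ι ℂ) b = Polynomial.C (MvPolynomial.C a) := by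
  rw [halfLinePoly, lineRestr₂_C, Polynomial.map_C, AlgHom.toRingHom_eq_coe, AlgHom.coe_toRingHom, MvPolynomial.algHom_C,
    MvPolynomial.algebraMap_eq]

/-- `halfLinePoly` is additive. [cite: Dimca1992, Ch. 4 §3 Prop. (3.1)] -/
theorem halfLinePoly_add (p q : MvPolynomial ι ℂ) : halfLinePoly (p + q) b = halfLinePoly p b + halfLinePoly q b := by
  rw [halfLinePoly, halfLinePoly, halfLinePoly, map_add, Polynomial.map_add]

/-- `halfLinePoly (p · x_k) = halfLinePoly p · (b_k + v_k X)`. [cite: Dimca1992, Ch. 4 §3 Prop. (3.1)] -/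
theorem halfLinePoly_mul_X (p : MvPolynomial ι ℂ) (k : ι) :
    halfLinePoly (p * X k) b = halfLinePoly p b * (Polynomial.C (MvPolynomial.C (b k)) + Polynomial.C (X k) * Polynomial.X) := by
  rw [halfLinePoly, halfLinePoly, map_mul, Polynomial.map_mul, lineRestr₂_X, Polynomial.map_add, Polynomial.map_mul,
    Polynomial.map_C, Polynomial.map_C, Polynomial.map_X, AlgHom.toRingHom_eq_coe, AlgHom.coe_toRingHom, baseSpz_X_inl,
    baseSpz_X_inr]

/-- **The `X^j`-coefficient of `h(b + X v)` is a form of degree `j` in `v`** (induction on `h`).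
[cite: Shafarevich1994, Book 1 II §6.4 (forms)] -/
theorem isHomogeneous_coeff_halfLinePoly (h : MvPolynomial ι ℂ) (j : ℕ) : ((halfLinePoly h b).coeff j).IsHomogeneous j := by
  induction h using MvPolynomial.induction_on generalizing j with
  | C a =>
    rw [halfLinePoly_C, Polynomial.coeff_C]
    split_ifs with hj
    · subst hj; exact MvPolynomial.isHomogeneous_C _ _
    · exact MvPolynomial.isHomogeneous_zero _ _ _
  | add p q hp hq =>
    rw [halfLinePoly_add, Polynomial.coeff_add]
    exact (hp j).add (hq j)
  | mul_X p k hp =>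
    rw [halfLinePoly_mul_X, mul_add, ← mul_assoc, Polynomial.coeff_add, Polynomial.coeff_mul_C]
    refine IsHomogeneous.add ?_ ?_
    · simpa only [add_zero] using (hp j).mul (MvPolynomial.isHomogeneous_C ι (b k))
    · cases j with
      | zero => rw [Polynomial.mul_coeff_zero, Polynomial.coeff_X_zero, mul_zero]; exact MvPolynomial.isHomogeneous_zero _ _ _
      | succ n =>
        rw [Polynomial.coeff_mul_X, Polynomial.coeff_mul_C]
        exact (hp n).mul (MvPolynomial.isHomogeneous_X ℂ k)

/-- **`h(b + X v)` at `X = 1` is the translate `h(b + v)`.** [cite: Dimca1992, Ch. 4 §3 Prop. (3.1)] -/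
theorem eval_one_halfLinePoly (h : MvPolynomial ι ℂ) :
    (halfLinePoly h b).eval 1 = Literature.Combinatorics.Extremal.translate b h := by
  refine MvPolynomial.funext fun v => ?_
  rw [Literature.Combinatorics.Extremal.eval_translate, ← Polynomial.coe_evalRingHom, ← RingHom.comp_apply]
  have hc : ((MvPolynomial.eval v).comp (Polynomial.evalRingHom (1 : MvPolynomial ι ℂ))) (halfLinePoly h b) =
      ((halfLinePoly h b).map (MvPolynomial.eval v)).eval (MvPolynomial.eval v 1) := by
    rw [RingHom.comp_apply, Polynomial.coe_evalRingHom, Polynomial.eval_map, Polynomial.eval₂_hom]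
  rw [hc, map_one, map_eval_halfLinePoly, eval_linePoly, one_smul, add_comm]

end Coeffs

/-! ### §2 Forms in `(v, t)` through `optionEquivLeft` -/

section OptionEquiv

variable {R : Type*} [CommRing R] {σ : Type}

/-- The degree of `m.optionElim j` is `j + deg m`. [folklore] -/
private theorem degree_optionElim (m : σ →₀ ℕ) (j : ℕ) : (m.optionElim j).degree = j + m.degree := by
  rw [Finsupp.degree_apply, Finsupp.degree_apply]
  have h := Finsupp.sum_option_index (m.optionElim j) (fun _ e => e) (fun _ => rfl) (fun _ _ _ => rfl)
  rw [Finsupp.optionElim_apply_none, Finsupp.some_optionElim] at h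
  exact h

/-- The weight-one weight is the degree. [folklore] -/
private theorem weight_one_eq_degree (d : σ →₀ ℕ) : Finsupp.weight (1 : σ → ℕ) d = d.degree := by
  rw [Finsupp.degree_eq_weight_one]
  rfl

/-- **Coefficients of a form beyond its degree vanish** (in the `t`-expansion through `optionEquivLeft`).
[cite: Shafarevich1994, Book 1 II §6.4] -/
theorem coeff_optionEquivLeft_eq_zero_of_lt {φ : MvPolynomial (Option σ) R} {n j : ℕ} (hφ : φ.IsHomogeneous n)
    (hj : n < j) : (optionEquivLeft R σ φ).coeff j = 0 := by
  ext m
  have key := optionEquivLeft_coeff_some_coeff_none R σ (m.optionElim j) φ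
  rw [Finsupp.some_optionElim, Finsupp.optionElim_apply_none] at key
  rw [key, MvPolynomial.coeff_zero]
  exact hφ.coeff_eq_zero (by rw [degree_optionElim]; omega)

/-- **A polynomial in `t` over `R[v]` whose `t^j`-coefficient is a form of degree `n − j` (`j ≤ n`) and vanishes for
`j > n` is a form of degree `n` in `(v, t)`** (converse of Mathlib's `coeff_isHomogeneous_of_optionEquivLeft_symm`).
[cite: Shafarevich1994, Book 1 II §6.4 (homogenisation)] -/
theorem isHomogeneous_optionEquivLeft_symm {f : (MvPolynomial σ R)[X]} {n : ℕ}
    (hcoeff : ∀ j, j ≤ n → (f.coeff j).IsHomogeneous (n - j)) (hz : ∀ j, n < j → f.coeff j = 0) :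
    ((optionEquivLeft R σ).symm f).IsHomogeneous n := by
  intro d hd
  have key := optionEquivLeft_coeff_some_coeff_none R σ d ((optionEquivLeft R σ).symm f)
  rw [AlgEquiv.apply_symm_apply] at key
  have hne : MvPolynomial.coeff d.some (f.coeff (d none)) ≠ 0 := by rw [key]; exact hd
  have hle : d none ≤ n := by
    by_contra hlt
    push Not at hlt
    rw [hz _ hlt, MvPolynomial.coeff_zero] at hne
    exact hne rfl
  have hdeg : d.some.degree = n - d none := by
    by_contra hne'
    exact hne ((hcoeff _ hle).coeff_eq_zero hne')
  rw [weight_one_eq_degree, ← Finsupp.optionElim_some d, degree_optionElim, hdeg]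
  omega

/-- **A form in `(v, t)` whose dehomogenisation `t = 1` is a constant `c` is `c · t^n`.**  In the `t`-expansion:
if `optionEquivLeft⁻¹ f` is a form of degree `n` and `f(1) = c ∈ R ⊂ R[v]`, then `f = c · X^n`.
[cite: Shafarevich1994, Book 1 II §6.4 (homogenisation and dehomogenisation)] -/
theorem eq_C_mul_X_pow_of_isHomogeneous_of_eval_one [Finite σ] {f : (MvPolynomial σ R)[X]} {n : ℕ}
    (hf : ((optionEquivLeft R σ).symm f).IsHomogeneous n) {c : R} (h1 : f.eval 1 = MvPolynomial.C c) :
    f = Polynomial.C (MvPolynomial.C c) * Polynomial.X ^ n := by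
  classical
  have hco : ∀ j, j ≤ n → (f.coeff j).IsHomogeneous (n - j) := fun j hj =>
    IsHomogeneous.coeff_isHomogeneous_of_optionEquivLeft_symm hf j (n - j) (by omega)
  have hz : ∀ j, n < j → f.coeff j = 0 := fun j hj => by
    have h := coeff_optionEquivLeft_eq_zero_of_lt hf hj
    rwa [AlgEquiv.apply_symm_apply] at h
  have hsum : ∑ j ∈ Finset.range (f.natDegree + 1), f.coeff j = MvPolynomial.C c := by
    rw [← h1, Polynomial.eval_eq_sum_range]
    exact Finset.sum_congr rfl fun j _ => by rw [one_pow, mul_one]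
  -- the coefficients below the top vanish: compare homogeneous components of `Σ_j coeff_j = c`
  have hlow : ∀ j, j < n → f.coeff j = 0 := by
    intro j hj
    have hk := congrArg (homogeneousComponent (n - j)) hsum
    rw [map_sum, homogeneousComponent_of_mem (MvPolynomial.isHomogeneous_C σ c), if_neg (by omega)] at hk
    rw [Finset.sum_eq_single j] at hk
    · rwa [homogeneousComponent_of_mem (hco j hj.le), if_pos rfl] at hk
    · intro i hi hij
      by_cases hin : i ≤ n
      · rw [homogeneousComponent_of_mem (hco i hin), if_neg (by omega)]
      · rw [hz i (by omega), map_zero]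
    · intro hjr
      rw [Polynomial.coeff_eq_zero_of_natDegree_lt (by simpa [Finset.mem_range, Nat.lt_succ_iff, not_le] using hjr), map_zero]
  have hothers : ∀ j, j ≠ n → f.coeff j = 0 := fun j hj => by
    rcases lt_or_gt_of_ne hj with h | h
    · exact hlow j h
    · exact hz j h
  -- the top coefficient is `c`
  have htop : f.coeff n = MvPolynomial.C c := by
    rw [Finset.sum_eq_single n (fun i _ hi => hothers i hi) (fun hn =>
      Polynomial.coeff_eq_zero_of_natDegree_lt (by simpa [Finset.mem_range, Nat.lt_succ_iff, not_le] using hn))] at hsum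
    exact hsum
  refine Polynomial.ext fun i => ?_
  rw [Polynomial.coeff_C_mul_X_pow]
  split_ifs with hi
  · rw [hi, htop]
  · exact hothers i hi

end OptionEquiv

/-! ### §3 Squarefreeness of `h(b + X v)` and the transversal line through `b` -/

section Main

variable [Fintype ι] {h : MvPolynomial ι ℂ} {b : ι → ℂ}

omit [Fintype ι] in
/-- A translate of a squarefree polynomial is squarefree (`translate b` is an automorphism of `ℂ[x]`). [folklore] -/
private theorem squarefree_translate (hsq : Squarefree h) (b : ι → ℂ) :
    Squarefree (Literature.Combinatorics.Extremal.translate b h) := by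
  intro y hy
  let E := Literature.Combinatorics.Extremal.translateEquiv (K := ℂ) b
  have hy' : E.symm y * E.symm y ∣ h := by
    obtain ⟨z, hz⟩ := hy
    refine ⟨E.symm z, E.injective ?_⟩
    rw [map_mul, map_mul, E.apply_symm_apply, E.apply_symm_apply, Literature.Combinatorics.Extremal.translateEquiv_apply, hz]
  have hu := (hsq _ hy').map E
  rwa [E.apply_symm_apply] at hu

/-- **`h` squarefree and `h(b) ≠ 0` ⇒ `h(b + X v)` is squarefree in `ℂ[v][X]`** (homogenisation argument of the
module docstring). [cite: Dimca1992, Ch. 4 §3 Prop. (3.1)] [cite: Shafarevich1994, Book 1 II §6.4] -/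
theorem squarefree_halfLinePoly (hsq : Squarefree h) (hb : MvPolynomial.eval b h ≠ 0) : Squarefree (halfLinePoly h b) := by
  classical
  have hh : h ≠ 0 := fun h0 => hb (by rw [h0, map_zero])
  set P := halfLinePoly h b with hP
  have hP0 : P.coeff 0 = MvPolynomial.C (MvPolynomial.eval b h) := coeff_zero_halfLinePoly h b
  have hPne : P ≠ 0 := fun h0 => by
    rw [h0, Polynomial.coeff_zero] at hP0
    exact hb (MvPolynomial.C_injective ι ℂ (by rw [← hP0, MvPolynomial.C_0]))
  intro x hx
  by_contra hxu
  obtain ⟨r, hr⟩ := hx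
  have hx0 : x ≠ 0 := fun h0 => hPne (by rw [hr, h0, zero_mul, zero_mul])
  have hr0 : r ≠ 0 := fun h0 => hPne (by rw [hr, h0, mul_zero])
  -- degrees and the reflection `Q = x̃ · x̃ · r̃`
  set α := x.natDegree with hα
  set ρ := r.natDegree with hρ
  have hdeg : P.natDegree = α + α + ρ := by
    rw [hr, Polynomial.natDegree_mul (mul_ne_zero hx0 hx0) hr0, Polynomial.natDegree_mul hx0 hx0]
  have hrefl : reflect P.natDegree P = reflect α x * reflect α x * reflect ρ r := by
    rw [hdeg, hr, reflect_mul (x * x) r (by rw [Polynomial.natDegree_mul hx0 hx0]) le_rfl, reflect_mul x x le_rfl le_rfl]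
  -- `Q` is a form of degree `deg P` in `(v, t)`
  let e := MvPolynomial.optionEquivLeft ℂ ι
  have hQhom : (e.symm (reflect P.natDegree P)).IsHomogeneous P.natDegree := by
    refine isHomogeneous_optionEquivLeft_symm (fun j hj => ?_) (fun j hj => ?_)
    · rw [coeff_reflect, revAt_le hj]
      exact isHomogeneous_coeff_halfLinePoly b h _
    · rw [coeff_reflect, revAt_eq_self_of_lt hj]
      exact Polynomial.coeff_eq_zero_of_natDegree_lt hj
  have hQ0 : e.symm (reflect P.natDegree P) ≠ 0 := by
    rw [Ne, map_eq_zero_iff _ e.symm.injective, reflect_eq_zero_iff]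
    exact hPne
  -- `x̃` divides the form `Q`, so it is a form of some degree `τ`
  have hxdvd : e.symm (reflect α x) ∣ e.symm (reflect P.natDegree P) :=
    ⟨e.symm (reflect α x * reflect ρ r), by rw [← map_mul, hrefl, mul_assoc]⟩
  have hxhom := Literature.NumberTheory.Transcendental.Roy2013.isHomogeneous_of_dvd hQhom hQ0 hxdvd
  set τ := (e.symm (reflect α x)).totalDegree with hτ
  -- dehomogenise: `P(1) = h(b + v)` is squarefree, so `x̃(1)` is a unit constant
  have hev : (reflect α x).eval 1 * (reflect α x).eval 1 ∣ Literature.Combinatorics.Extremal.translate b h := by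
    refine ⟨(reflect ρ r).eval 1, ?_⟩
    rw [← eval_one_halfLinePoly, ← hP, ← Polynomial.eval_mul, ← Polynomial.eval_mul, ← hrefl]
    haveI : Invertible (1 : MvPolynomial ι ℂ) := invertibleOne
    have h1 := Polynomial.eval₂_reflect_mul_pow (RingHom.id _) (1 : MvPolynomial ι ℂ) P.natDegree P le_rfl
    rw [one_pow, mul_one, Polynomial.eval₂_id, invOf_one] at h1
    rw [← Polynomial.eval₂_id, ← h1]
  have hunit := squarefree_translate hsq b _ hev
  obtain ⟨c, hc, hceq⟩ := MvPolynomial.isUnit_iff_eq_C_of_isReduced.1 hunit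
  -- hence `x̃ = c · X^τ`
  have hxt : reflect α x = Polynomial.C (MvPolynomial.C c) * Polynomial.X ^ τ :=
    eq_C_mul_X_pow_of_isHomogeneous_of_eval_one hxhom hceq
  -- read off the coefficients of `x`: `x.coeff i = 0` unless `α - i = τ`
  have hxcoeff : ∀ i, i ≤ α → i ≠ α - τ → x.coeff i = 0 := by
    intro i hi hne
    have h1 : (reflect α x).coeff (α - i) = x.coeff i := by
      rw [coeff_reflect, revAt_le (Nat.sub_le α i), Nat.sub_sub_self hi]
    rw [← h1, hxt, Polynomial.coeff_C_mul_X_pow, if_neg (by omega)]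
  have hlead : (reflect α x).coeff 0 = x.leadingCoeff := by
    rw [coeff_reflect, revAt_le (Nat.zero_le α), Nat.sub_zero, Polynomial.leadingCoeff]
  have hτα : τ ≤ α := by
    by_contra hlt
    push Not at hlt
    have h0 : (reflect α x).coeff 0 = 0 := by
      rw [hxt, Polynomial.coeff_C_mul_X_pow, if_neg (by omega)]
    rw [hlead, Polynomial.leadingCoeff_eq_zero] at h0
    exact hx0 h0
  by_cases hk : α - τ = 0
  · -- `x` is a constant `a₀ ∈ A`; `a₀² ∣ coeff_0 P = h(b)` makes it a unit
    have hxC : x = Polynomial.C (x.coeff 0) := by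
      refine Polynomial.ext fun i => ?_
      rw [Polynomial.coeff_C]
      split_ifs with hi
      · rw [hi]
      · by_cases hiα : i ≤ α
        · exact hxcoeff i hiα (by omega)
        · exact Polynomial.coeff_eq_zero_of_natDegree_lt (by push Not at hiα; exact hiα)
    apply hxu
    have hdv : Polynomial.C (x.coeff 0) ∣ P := ⟨x * r, by rw [hr, hxC, Polynomial.coeff_C_zero, mul_assoc]⟩
    have hdv0 : x.coeff 0 ∣ MvPolynomial.C (MvPolynomial.eval b h) := by
      have := (Polynomial.C_dvd_iff_dvd_coeff _ _).1 hdv 0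
      rwa [hP0] at this
    rw [hxC]
    exact Polynomial.isUnit_C.2 (isUnit_of_dvd_unit hdv0
      ((MvPolynomial.isUnit_iff_eq_C_of_isReduced).2 ⟨_, isUnit_iff_ne_zero.2 hb, rfl⟩))
  · -- `X ∣ x ∣ P`, contradicting `coeff_0 P = h(b) ≠ 0`
    have hx00 : x.coeff 0 = 0 := hxcoeff 0 (Nat.zero_le _) (fun h0 => hk h0.symm)
    have hP00 : P.coeff 0 = 0 := by
      rw [hr, mul_assoc, Polynomial.mul_coeff_zero, hx00, zero_mul]
    rw [hP00] at hP0
    exact hb (MvPolynomial.C_injective ι ℂ (by rw [← hP0, MvPolynomial.C_0]))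

/-- **FIXED-BASE BERTINI for the pencil discriminant**: if `h` is squarefree and `h(b) ≠ 0`, some line through `b`
meets `V(h)` transversally in `deg h` points: `pencilDiscr h (b, v) ≠ 0` for some direction `v` (hence for all `v` off
a proper algebraic subset).  [cite: Dimca1992, Ch. 4 §3 Prop. (3.1) and the remark after it] -/
theorem exists_eval_pencilDiscr_ne_zero_of_squarefree (hsq : Squarefree h) (hb : MvPolynomial.eval b h ≠ 0) :
    ∃ v : ι → ℂ, MvPolynomial.eval (Sum.elim b v) (pencilDiscr h) ≠ 0 :=
  exists_eval_pencilDiscr_ne_zero_of_squarefree_halfLinePoly h b (squarefree_halfLinePoly hsq hb) hb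

omit [Fintype ι] in
/-- **Conversely, `pencilDiscr h ≠ 0` forces `h` squarefree**: along a pointed line with `pencilDiscr ≠ 0` the
restriction is separable of full degree `deg h`, while a square factor `a² ∣ h` with `a` non-constant would restrict to
a square factor of positive degree. [cite: Dimca1992, Ch. 4 §3 Prop. (3.1)] -/
theorem squarefree_of_pencilDiscr_ne_zero (hQ : pencilDiscr h ≠ 0) : Squarefree h := by
  classical
  obtain ⟨bv, hbv⟩ := exists_eval_ne_zero_of_ne_zero hQ
  have hQ' : MvPolynomial.eval (Sum.elim (bv ∘ Sum.inl) (bv ∘ Sum.inr)) (pencilDiscr h) ≠ 0 := by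
    have : Sum.elim (bv ∘ Sum.inl) (bv ∘ Sum.inr) = bv := by
      funext k; rcases k with k | k <;> rfl
    rwa [this]
  set b := bv ∘ Sum.inl
  set v := bv ∘ Sum.inr
  have hb : MvPolynomial.eval b h ≠ 0 := eval_ne_zero_of_pencilDiscr hQ'
  have hh : h ≠ 0 := fun h0 => hb (by rw [h0, map_zero])
  have hsep := separable_linePoly_of_pencilDiscr hQ'
  have hdegL : (linePoly h b v).natDegree = h.totalDegree := by
    rw [natDegree_linePoly_of_pencilDiscr hQ', natDegree_lineRestr₂ hh]
  intro a ha
  obtain ⟨c, hc⟩ := ha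
  by_contra hau
  -- `a` is non-constant (non-units of `ℂ[x]` dividing `h ≠ 0`)
  have ha0 : a ≠ 0 := fun h0 => hh (by rw [hc, h0, zero_mul, zero_mul])
  have hc0 : c ≠ 0 := fun h0 => hh (by rw [hc, h0, mul_zero])
  have hapos : 0 < a.totalDegree := by
    by_contra hle
    push Not at hle
    have hle0 : a.totalDegree = 0 := Nat.le_zero.1 hle
    have hr := MvPolynomial.totalDegree_eq_zero_iff_eq_C.1 hle0
    apply hau
    rw [hr]
    refine (MvPolynomial.isUnit_iff_eq_C_of_isReduced).2 ⟨_, isUnit_iff_ne_zero.2 fun h0 => ha0 ?_, rfl⟩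
    rw [hr, h0, MvPolynomial.C_0]
  -- the restriction of `a` has positive degree, and its square divides the separable restriction of `h`
  have hmul : linePoly h b v = linePoly a b v * linePoly a b v * linePoly c b v := by
    rw [linePoly, linePoly, linePoly, hc, map_mul, map_mul, Polynomial.map_mul, Polynomial.map_mul]
  have hsqL : Squarefree (linePoly h b v) := hsep.squarefree
  have hua : IsUnit (linePoly a b v) := hsqL _ ⟨linePoly c b v, hmul⟩
  have hdeg_a : (linePoly a b v).natDegree = 0 := Polynomial.natDegree_eq_zero_of_isUnit hua
  -- degree count: `deg h = 2 deg_X a(b+Xv) + deg_X c(b+Xv) ≤ 0 + 0 + deg c < deg h`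
  have hla0 : linePoly a b v ≠ 0 := hua.ne_zero
  have hlc0 : linePoly c b v ≠ 0 := fun h0 => by
    rw [h0, mul_zero] at hmul; exact (linePoly_ne_zero hb v) hmul
  have hsum : (linePoly h b v).natDegree = (linePoly a b v).natDegree + (linePoly a b v).natDegree + (linePoly c b v).natDegree := by
    rw [hmul, Polynomial.natDegree_mul (mul_ne_zero hla0 hla0) hlc0, Polynomial.natDegree_mul hla0 hla0]
  have hcle : (linePoly c b v).natDegree ≤ c.totalDegree :=
    (natDegree_linePoly_le c b v).trans (by rw [natDegree_lineRestr₂ hc0])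
  have htot : h.totalDegree = a.totalDegree + a.totalDegree + c.totalDegree := by
    rw [hc, MvPolynomial.totalDegree_mul_of_isDomain (mul_ne_zero ha0 ha0) hc0, MvPolynomial.totalDegree_mul_of_isDomain ha0 ha0]
  omega

end Main

end Literature.AlgebraicGeometry.FundamentalGroup

end
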